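import Summits.QuantumFields.BalabanUV.T4Continuum.Support.RegionStarLineGauge

/-!
# `BalabanUV.T4Continuum.Support.RegionStarLineGaugeRegion` — NE2 (node U1a) formalisation swarm, SUPPLIER item «Δ1-COERC-ORTH-LINE» under
# the owner's sub-row `T4-U1a.S-NE2-D1-DIRICHLET°` (vector layer, W1): THE LINE GAUGE ON AN `e`-THIN BLOCK SET — the Dirichlet scalar
# `lineGauge A` on `Ω = blockReg n M S` built from a star-bond field `A` by `RegionStarLineGauge.muT`, and its residual `A − ∂_Ω(lineGauge A)`
# computed EXACTLY on every star bond: `ℓ/(n+1)` on `e`-bonds, partial curl sums on transverse bonds; pointwise squared bounds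
# (unit b2b-balaban-t4-ne2-formalise-leaf-09, gen 9, v1)

HONEST FRAMING (T4-DAG p. 1).  [folklore] `U = 1` lattice calculus, ONE region of a restricted class (`IsEThin e S`: no two blocks of `S` are
`e`-adjacent or `(e,ν)`-diagonally adjacent — single blocks, `e`-slabs of thickness one, rods, `e`-thin cylinders), ONE averaging scale, finite
torus; identities and pointwise bounds only — the summed estimate and the W1 END are in the sequel `RegionStarLineGaugeBound`; nothing printed
is a hypothesis; NE2 (U1a) NOT proved; spine PROVED 0/9 unchanged; NOT [B9] (3.23)–(3.27) as printed; NOT infinite volume, NOT the mass gap, NOT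
Clay.  HONEST DEPENDENCY (verbatim): «continuum YM on T⁴ ⇐ BetaPertH ∧ nine spine estimates (0/9 proved); BetaPertH ⇐ (D1) ∧ (D4) ∧ CAP+tail;
G-an2-4 gates asym, D1 and NE2/3/4.»

WHAT THIS FILE PROVES (0 sorry):
 * §1 [shape] **`IsEThin e S`** (hypothesis STRUCTURE on the block set: `S y → ¬S (y + e)`, `S y → ¬S (y ± e_ν + e)` for `ν ≠ e`); the exterior-line
   lemma `muT_eq_zero_of_exterior`; the Dirichlet extension `μ̄ = ext Ω (lineGauge A)` equals `muT` at both ends of every star bond.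
 * §2 THE ANCHORS (`anchor_start`/`_end`/`_start_inward`/`_end_inward`): on an `e`-thin set the two tangential bonds `(xstart x, ν)`,
   `(xstart x + (n+1)·e, ν)` of every relevant line carry no field — the lattice electric boundary condition.
 * §3 THE RESIDUAL `res A = ext A − ∂(ext Ω (lineGauge A))`: **`nsq_sub_gradR_lineGauge`** (`nsq (A − gradR (lineGauge A)) = nsq (res A)`), and its
   exact values **`res_e_of_mem`** ∕ **`res_e_of_inward`** (`ℓ(x̂)/(n+1)`) and **`res_nu_eq`** (partial curl sums) on every star bond.
 * §4 POINTWISE BOUNDS **`norm_sq_res_e_le`** (`‖res (x,e)‖² ≤ (1_Ω(x)‖ℓ(x)‖² + 1_Ω(x+e)‖ℓ(x+e)‖²)/(n+1)²`) and **`norm_sq_res_nu_le`**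
   (`‖res (x,ν)‖² ≤ (4/n)·(1_Ω(x) + 1_Ω(x+e_ν))·lineCurl ν x`, `lineCurl ν x = Σ_{s ≤ n} ‖F_{eν}(xstart x + s·e)‖²`).

ABSOLUTE RULE (cell, verbatim): «No internally-minted statement may enter as a cited fact. Every hypothesis is either kernel-proved in
this package or a verbatim quotation of a PUBLISHED theorem with page reference. The manuscript(s) under audit are NOT citable for
their own disputed steps — they are the thing under adjudication; programme-internal (2001/route/tribunal) claims are never citable.»
[folklore] throughout; `IsEThin` is a parametric hypothesis structure on data (like `SliceData`), data defs `lineGauge`, `res`, `lineCurl`;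
no `def … : Prop` fact.  NOT CLAIMED: the summed estimate, W1, NE2, NE3; «not in print; our construction».
-/

noncomputable section

open scoped BigOperators ComplexConjugate Matrix
open Finset

namespace Summit.QuantumFields.BalabanUV.T4Continuum.RegionStarLineGaugeRegion

open Literature.MathematicalPhysics.QuantumFieldTheory.Balaban1983to89.B5Prop11Plancherel (Tor fine unitVec)
open Literature.MathematicalPhysics.QuantumFieldTheory.Balaban1983to89.B5Action121 (Fs GradOp GradOp_mulVec sdiff_mulVec)
open Literature.MathematicalPhysics.QuantumFieldTheory.Balaban1983to89.B5Block118 (bpt tstep tstep_zero tstep_succ)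
open Literature.MathematicalPhysics.QuantumFieldTheory.Balaban1983to89.B5Blocks16 (blockOf blockOf_bpt)
open Summit.QuantumFields.BalabanUV.T4Continuum
open Summit.QuantumFields.BalabanUV.T4Continuum.SubtypeCompression (ext ext_apply_of ext_apply_of_not nsq_ext)
open Summit.QuantumFields.BalabanUV.T4Continuum.RegionGaugeFixedVector (starReg gradR)
open Summit.QuantumFields.BalabanUV.T4Continuum.RegionGaugeFixedVectorFlat (blockOf_add_unitVec)
open Summit.QuantumFields.BalabanUV.T4Continuum.RegionStarLineGauge
open Summit.QuantumFields.BalabanUV.Beta.GAN24.DirichletBoxCompression (toBlock_mulVec')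
open Summit.QuantumFields.BalabanUV.Beta.GAN24.DirichletBoxTrace (blockReg)
open Literature.MathematicalPhysics.QuantumFieldTheory.Balaban1983to89.B5Prop11Lower (nsq)

variable {d : ℕ} (n : ℕ) [NeZero n] (M : Fin d → ℕ) [hM : ∀ μ, NeZero (M μ)] (e : Fin d) (S : Tor M → Prop) [DecidablePred S]

/-! ## §1 `e`-thin block sets, exterior lines, the Dirichlet extension of the line gauge -/

/-- [shape] **`e`-THIN BLOCK SETS** (hypothesis structure on data): no block of `S` has its `e`-successor in `S`, and no block of `S` has an
`(e,ν)`-diagonal neighbour `y ± e_ν + e` in `S` (`ν ≠ e`).  Examples: a single block, an `e`-slab of thickness one, a rod or any cylinder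
`{y : y_e ∈ I ∧ T(y⊥)}` with `I` without consecutive elements (on a torus with `M_e ≥ 2`). [folklore] -/
structure IsEThin : Prop where
  /-- no two `e`-stacked blocks -/
  noStack : ∀ y, S y → ¬ S (y + unitVec M e)
  /-- no `(e,ν)`-diagonal pairs -/
  noDiag : ∀ y (ν : Fin d), ν ≠ e → S y → ¬ S (y + unitVec M ν + unitVec M e) ∧ ¬ S (y - unitVec M ν + unitVec M e)

variable {S}

omit hM [DecidablePred S] in
/-- the `e`-predecessor of a block of `S` is not in `S`. [folklore] -/
theorem IsEThin.noStack' (h : IsEThin M e S) {y : Tor M} (hy : S y) : ¬ S (y - unitVec M e) :=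
  fun h' => h.noStack _ h' (by rwa [sub_add_cancel])

omit hM [DecidablePred S] in
/-- the lower diagonal neighbours `y ± e_ν − e` of a block of `S` are not in `S`. [folklore] -/
theorem IsEThin.noDiag' (h : IsEThin M e S) {y : Tor M} {ν : Fin d} (hν : ν ≠ e) (hy : S y) :
    ¬ S (y + unitVec M ν - unitVec M e) ∧ ¬ S (y - unitVec M ν - unitVec M e) := by
  refine ⟨fun h' => (h.noDiag _ ν hν h').2 ?_, fun h' => (h.noDiag _ ν hν h').1 ?_⟩ <;> convert hy using 2 <;> abel

variable (S)
variable (A : {b // starReg n M S b} → ℂ)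

/-- a bond with both endpoints outside `Ω` is not a star bond: the zero-extension of `A` vanishes there. [folklore] -/
theorem extA_eq_zero {z : Tor (fine n M)} {ν : Fin d} (h1 : ¬ blockReg n M S z) (h2 : ¬ blockReg n M S (z + unitVec (fine n M) ν)) :
    ext (starReg n M S) A (z, ν) = 0 :=
  ext_apply_of_not _ _ (by rintro (h | h) <;> [exact h1 h; exact h2 h])

omit [DecidablePred S] in
/-- the sites of the line of `z` lie outside `Ω` when the block of `z` and its two `e`-neighbours avoid `S`. [folklore] -/
theorem not_blockReg_lineSite {z : Tor (fine n M)} (hz : ¬ S (blockOf n M z)) (hz' : ¬ S (blockOf n M z - unitVec M e))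
    (hz'' : ¬ S (blockOf n M z + unitVec M e)) {s : ℕ} (hs : s ≤ n + 1) :
    ¬ blockReg n M S (xstart n M e z + tstep (fine n M) e s) := by
  show ¬ S (blockOf n M (xstart n M e z + tstep (fine n M) e s))
  rcases Nat.eq_zero_or_pos s with rfl | hpos
  · rwa [tstep_zero, add_zero, blockOf_xstart]
  · rcases Nat.lt_or_ge s (n + 1) with hlt | hge
    · obtain ⟨s', rfl⟩ : ∃ s', s = s' + 1 := ⟨s - 1, by omega⟩
      rwa [blockOf_xstart_add_tstep_succ n M e z (by omega)]
    · rwa [show s = n + 1 by omega, blockOf_xstart_add_tstep_end]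

/-- **AN EXTERIOR LINE CARRIES NO DATA**: if the block of `z` and its two `e`-neighbouring blocks avoid `S`, every partial line sum vanishes,
`pathSum (ext A) z k = 0` for `k ≤ n + 1`. [folklore] -/
theorem pathSum_eq_zero_of_exterior {z : Tor (fine n M)} (hz : ¬ S (blockOf n M z)) (hz' : ¬ S (blockOf n M z - unitVec M e))
    (hz'' : ¬ S (blockOf n M z + unitVec M e)) {k : ℕ} (hk : k ≤ n + 1) : pathSum n M e (ext (starReg n M S) A) z k = 0 := by
  unfold pathSum
  refine sum_eq_zero fun s hs => ?_
  have hs' : s < k := mem_range.mp hs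
  refine extA_eq_zero n M S A (not_blockReg_lineSite n M e S hz hz' hz'' (by omega)) ?_
  rw [add_assoc, ← tstep_succ]
  exact not_blockReg_lineSite n M e S hz hz' hz'' (by omega)

/-- … hence `ℓ = 0` and `μ = 0` there. [folklore] -/
theorem muT_eq_zero_of_exterior {z : Tor (fine n M)} (hz : ¬ S (blockOf n M z)) (hz' : ¬ S (blockOf n M z - unitVec M e))
    (hz'' : ¬ S (blockOf n M z + unitVec M e)) : muT n M e (ext (starReg n M S) A) z = 0 := by
  have hlt := edig_lt n M e z
  rw [muT, ell, pathSum_eq_zero_of_exterior n M e S A hz hz' hz'' (by omega), pathSum_eq_zero_of_exterior n M e S A hz hz' hz'' le_rfl,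
    mul_zero, mul_zero, sub_zero]

/-- **THE LINE GAUGE OF THE REGION**: the Dirichlet scalar `x ↦ μ(x)` on `Ω` (torus line gauge of the zero-extension of `A`, read on `Ω`).
[folklore] -/
def lineGauge : {x // blockReg n M S x} → ℂ := fun x => muT n M e (ext (starReg n M S) A) x.1

/-- its Dirichlet extension agrees with `μ` on `Ω` … [folklore] -/
theorem ext_lineGauge_of_mem {z : Tor (fine n M)} (hz : blockReg n M S z) :
    ext (blockReg n M S) (lineGauge n M e S A) z = muT n M e (ext (starReg n M S) A) z :=
  ext_apply_of (blockReg n M S) (lineGauge n M e S A) ⟨z, hz⟩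

/-- … and vanishes off `Ω`. [folklore] -/
theorem ext_lineGauge_of_not_mem {z : Tor (fine n M)} (hz : ¬ blockReg n M S z) : ext (blockReg n M S) (lineGauge n M e S A) z = 0 :=
  ext_apply_of_not _ _ hz

variable {S}

omit [DecidablePred S] in
/-- the block of an exterior site whose transverse neighbour is in `Ω`. [folklore] -/
theorem blockOf_of_inward {x : Tor (fine n M)} {ν : Fin d} (hx : ¬ blockReg n M S x) (hx' : blockReg n M S (x + unitVec (fine n M) ν)) :
    blockOf n M x = blockOf n M (x + unitVec (fine n M) ν) - unitVec M ν := by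
  rcases blockOf_add_unitVec n M x ν with h | h
  · exact absurd (show S (blockOf n M x) by rw [← h]; exact hx') hx
  · rw [h, add_sub_cancel_right]

omit [DecidablePred S] in
/-- the block of a transverse neighbour outside `Ω` of a site of `Ω`. [folklore] -/
theorem blockOf_of_outward {x : Tor (fine n M)} {ν : Fin d} (hx : blockReg n M S x) (hx' : ¬ blockReg n M S (x + unitVec (fine n M) ν)) :
    blockOf n M (x + unitVec (fine n M) ν) = blockOf n M x + unitVec M ν := by
  rcases blockOf_add_unitVec n M x ν with h | h
  · exact absurd (show S (blockOf n M (x + unitVec (fine n M) ν)) by rw [h]; exact hx) hx'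
  · exact h

/-- **`μ̄ = μ` AT THE FAR END OF A TRANSVERSE STAR BOND FROM `Ω`**: for `x ∈ Ω`, `ν ≠ e`: `μ̄(x + e_ν) = μ(x + e_ν)` (inside `Ω` by definition;
outside, the line of `x + e_ν` is exterior on an `e`-thin set and both sides vanish). [folklore] -/
theorem ext_lineGauge_add_unitVec_ne (h : IsEThin M e S) {x : Tor (fine n M)} (hx : blockReg n M S x) {ν : Fin d} (hν : ν ≠ e) :
    ext (blockReg n M S) (lineGauge n M e S A) (x + unitVec (fine n M) ν) = muT n M e (ext (starReg n M S) A) (x + unitVec (fine n M) ν) := by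
  by_cases hx' : blockReg n M S (x + unitVec (fine n M) ν)
  · exact ext_lineGauge_of_mem n M e S A hx'
  · have hb := blockOf_of_outward n M hx hx'
    have hS : ¬ S (blockOf n M (x + unitVec (fine n M) ν)) := hx'
    rw [ext_lineGauge_of_not_mem n M e S A hx', muT_eq_zero_of_exterior n M e S A hS]
    · rw [hb]; exact (h.noDiag' M e hν hx).1
    · rw [hb]; exact (h.noDiag _ ν hν hx).1

/-- **`μ̄ = μ = 0` AT AN EXTERIOR SITE WITH A TRANSVERSE NEIGHBOUR IN `Ω`** (`ν ≠ e`; its line is exterior). [folklore] -/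
theorem muT_eq_zero_of_inward (h : IsEThin M e S) {x : Tor (fine n M)} {ν : Fin d} (hν : ν ≠ e) (hx : ¬ blockReg n M S x)
    (hx' : blockReg n M S (x + unitVec (fine n M) ν)) : muT n M e (ext (starReg n M S) A) x = 0 := by
  have hb := blockOf_of_inward n M hx hx'
  have hy : S (blockOf n M (x + unitVec (fine n M) ν)) := hx'
  refine muT_eq_zero_of_exterior n M e S A hx ?_ ?_
  · rw [hb]; exact (h.noDiag' M e hν hy).2
  · rw [hb]; exact (h.noDiag _ ν hν hy).2

/-! ## §2 The anchors: exterior tangential bonds of a line carry no field -/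

/-- **START ANCHOR** for `x ∈ Ω`: `(ext A)(xstart x, ν) = 0` (`ν ≠ e`). [folklore] -/
theorem anchor_start (h : IsEThin M e S) {x : Tor (fine n M)} (hx : blockReg n M S x) {ν : Fin d} (hν : ν ≠ e) :
    ext (starReg n M S) A (xstart n M e x, ν) = 0 := by
  have hy : S (blockOf n M x) := hx
  have h1 : ¬ blockReg n M S (xstart n M e x) := by
    show ¬ S (blockOf n M (xstart n M e x)); rw [blockOf_xstart]; exact h.noStack' M e hy
  refine extA_eq_zero n M S A h1 ?_
  show ¬ S (blockOf n M (xstart n M e x + unitVec (fine n M) ν))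
  rcases blockOf_add_unitVec n M (xstart n M e x) ν with h2 | h2 <;> rw [h2, blockOf_xstart]
  · exact h.noStack' M e hy
  · rw [sub_add_eq_add_sub]; exact (h.noDiag' M e hν hy).1

/-- **END ANCHOR** for `x ∈ Ω`: `(ext A)(xstart x + (n+1)·e, ν) = 0` (`ν ≠ e`). [folklore] -/
theorem anchor_end (h : IsEThin M e S) {x : Tor (fine n M)} (hx : blockReg n M S x) {ν : Fin d} (hν : ν ≠ e) :
    ext (starReg n M S) A (xstart n M e x + tstep (fine n M) e (n + 1), ν) = 0 := by
  have hy : S (blockOf n M x) := hx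
  have h1 : ¬ blockReg n M S (xstart n M e x + tstep (fine n M) e (n + 1)) := by
    show ¬ S (blockOf n M _); rw [blockOf_xstart_add_tstep_end]; exact h.noStack _ hy
  refine extA_eq_zero n M S A h1 ?_
  show ¬ S (blockOf n M (xstart n M e x + tstep (fine n M) e (n + 1) + unitVec (fine n M) ν))
  rcases blockOf_add_unitVec n M (xstart n M e x + tstep (fine n M) e (n + 1)) ν with h2 | h2 <;> rw [h2, blockOf_xstart_add_tstep_end]
  · exact h.noStack _ hy
  · rw [add_right_comm]; exact (h.noDiag _ ν hν hy).1

/-- **START ANCHOR** for an exterior `x` with `x + e_ν ∈ Ω` (`ν ≠ e`). [folklore] -/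
theorem anchor_start_inward (h : IsEThin M e S) {x : Tor (fine n M)} {ν : Fin d} (hν : ν ≠ e) (hx : ¬ blockReg n M S x)
    (hx' : blockReg n M S (x + unitVec (fine n M) ν)) : ext (starReg n M S) A (xstart n M e x, ν) = 0 := by
  have hb := blockOf_of_inward n M hx hx'
  have hy : S (blockOf n M (x + unitVec (fine n M) ν)) := hx'
  refine extA_eq_zero n M S A ?_ ?_
  · show ¬ S (blockOf n M (xstart n M e x)); rw [blockOf_xstart, hb]; exact (h.noDiag' M e hν hy).2
  · show ¬ S (blockOf n M (xstart n M e x + unitVec (fine n M) ν))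
    rw [← xstart_add_unitVec_ne n M e x hν, blockOf_xstart]; exact h.noStack' M e hy

/-- **END ANCHOR** for an exterior `x` with `x + e_ν ∈ Ω` (`ν ≠ e`). [folklore] -/
theorem anchor_end_inward (h : IsEThin M e S) {x : Tor (fine n M)} {ν : Fin d} (hν : ν ≠ e) (hx : ¬ blockReg n M S x)
    (hx' : blockReg n M S (x + unitVec (fine n M) ν)) :
    ext (starReg n M S) A (xstart n M e x + tstep (fine n M) e (n + 1), ν) = 0 := by
  have hb := blockOf_of_inward n M hx hx'
  have hy : S (blockOf n M (x + unitVec (fine n M) ν)) := hx'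
  refine extA_eq_zero n M S A ?_ ?_
  · show ¬ S (blockOf n M _); rw [blockOf_xstart_add_tstep_end, hb]; exact (h.noDiag _ ν hν hy).2
  · show ¬ S (blockOf n M (xstart n M e x + tstep (fine n M) e (n + 1) + unitVec (fine n M) ν))
    rw [add_right_comm, ← xstart_add_unitVec_ne n M e x hν, blockOf_xstart_add_tstep_end]; exact h.noStack _ hy

/-! ## §3 The residual on the torus and its exact values -/

variable (S)

/-- the RESIDUAL of the line gauge, on the torus: `res A = ext A − ∂(ext_Ω μ)`, `∂ = GradOp … (n:ℂ)`. [folklore] -/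
def res : Tor (fine n M) × Fin d → ℂ :=
  ext (starReg n M S) A - GradOp (fine n M) (n : ℂ) *ᵥ ext (blockReg n M S) (lineGauge n M e S A)

/-- `res A (x,ν) = (ext A)(x,ν) − n·(μ̄(x + e_ν) − μ̄(x))`. [folklore] -/
theorem res_apply (x : Tor (fine n M)) (ν : Fin d) :
    res n M e S A (x, ν) = ext (starReg n M S) A (x, ν)
      - (n : ℂ) * (ext (blockReg n M S) (lineGauge n M e S A) (x + unitVec (fine n M) ν) - ext (blockReg n M S) (lineGauge n M e S A) x) := by
  rw [res, Pi.sub_apply, GradOp_mulVec, sdiff_mulVec]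

/-- off the star bonds the residual vanishes. [folklore] -/
theorem res_of_not_star {b : Tor (fine n M) × Fin d} (hb : ¬ starReg n M S b) : res n M e S A b = 0 := by
  obtain ⟨x, ν⟩ := b
  rw [res_apply, ext_apply_of_not _ _ hb, ext_lineGauge_of_not_mem n M e S A (fun h => hb (Or.inl h)),
    ext_lineGauge_of_not_mem n M e S A (fun h => hb (Or.inr h)), sub_zero, mul_zero, sub_zero]

/-- **`res A` IS THE ZERO-EXTENSION OF `A − ∂_Ω(lineGauge A)`**. [folklore] -/
theorem ext_sub_gradR_lineGauge : ext (starReg n M S) (A - gradR n M S *ᵥ lineGauge n M e S A) = res n M e S A := by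
  funext b
  by_cases hb : starReg n M S b
  · rw [ext_apply_of (starReg n M S) _ ⟨b, hb⟩, Pi.sub_apply, res, Pi.sub_apply, ext_apply_of (starReg n M S) _ ⟨b, hb⟩, gradR,
      toBlock_mulVec']
  · rw [ext_apply_of_not _ _ hb, res_of_not_star n M e S A hb]

/-- hence **`nsq (A − ∂_Ω(lineGauge A)) = nsq (res A)`**. [folklore] -/
theorem nsq_sub_gradR_lineGauge : nsq (A - gradR n M S *ᵥ lineGauge n M e S A) = nsq (res n M e S A) := by
  rw [← ext_sub_gradR_lineGauge, nsq_ext]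

variable {S}

/-- **THE `e`-RESIDUAL AT A SITE OF `Ω`**: `res A (x,e) = ℓ(x)/(n+1)` (interior bond of the line, or the outward bond at the last site).
[folklore] -/
theorem res_e_of_mem (h : IsEThin M e S) {x : Tor (fine n M)} (hx : blockReg n M S x) :
    res n M e S A (x, e) = ell n M e (ext (starReg n M S) A) x / ((n : ℂ) + 1) := by
  have hlt := edig_lt n M e x
  rw [res_apply, ext_lineGauge_of_mem n M e S A hx]
  by_cases hc : edig n M e x + 1 < n
  · have hx' : blockReg n M S (x + unitVec (fine n M) e) := by
      show S (blockOf n M _); rw [blockOf_add_unitVec_e_of_lt n M e x hc]; exact hx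
    rw [ext_lineGauge_of_mem n M e S A hx', res_e_interior n M e x hc]
  · have hc' : edig n M e x + 1 = n := by omega
    have hx' : ¬ blockReg n M S (x + unitVec (fine n M) e) := by
      show ¬ S (blockOf n M _); rw [blockOf_add_unitVec_e_of_eq n M e x hc']; exact h.noStack _ hx
    rw [ext_lineGauge_of_not_mem n M e S A hx', zero_sub, mul_neg, sub_neg_eq_add, res_e_last n M e x hc']

/-- **THE `e`-RESIDUAL ON AN INWARD BOND**: for `x ∉ Ω` with `x + e ∈ Ω`, `res A (x,e) = ℓ(x + e)/(n+1)`. [folklore] -/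
theorem res_e_of_inward {x : Tor (fine n M)} (hx : ¬ blockReg n M S x) (hx' : blockReg n M S (x + unitVec (fine n M) e)) :
    res n M e S A (x, e) = ell n M e (ext (starReg n M S) A) (x + unitVec (fine n M) e) / ((n : ℂ) + 1) := by
  set z := x + unitVec (fine n M) e with hz
  -- `z` is a first site: otherwise `x = z − e` lies in the block of `z`
  have h0 : edig n M e z = 0 := by
    by_contra hne
    have hb := blockOf_sub_unitVec_e n M e z hne
    rw [hz, add_sub_cancel_right] at hb
    exact hx (show S (blockOf n M x) by rw [hb]; exact hx')
  have hs : xstart n M e z = x := by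
    have := xstart_add_unitVec_of_edig_zero n M e z h0
    rw [hz] at this
    exact add_right_cancel this
  rw [res_apply, ← hz, ext_lineGauge_of_mem n M e S A hx', ext_lineGauge_of_not_mem n M e S A hx, sub_zero, ← res_e_first n M e z h0, hs]

/-- **THE TRANSVERSE RESIDUAL ON EVERY STAR `ν`-BOND** (`ν ≠ e`) of an `e`-thin set:
`res A (x,ν) = n⁻¹·curlSum x (edig x + 1) − (edig x + 1)/(n(n+1))·curlSum x (n+1)`. [folklore] -/
theorem res_nu_eq (h : IsEThin M e S) {x : Tor (fine n M)} {ν : Fin d} (hν : ν ≠ e) (hb : starReg n M S (x, ν)) :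
    res n M e S A (x, ν)
      = (n : ℂ)⁻¹ * curlSum n M e (ext (starReg n M S) A) ν x (edig n M e x + 1)
        - ((edig n M e x + 1 : ℕ) : ℂ) / ((n : ℂ) * ((n : ℂ) + 1)) * curlSum n M e (ext (starReg n M S) A) ν x (n + 1) := by
  rw [res_apply]
  by_cases hx : blockReg n M S x
  · rw [ext_lineGauge_of_mem n M e S A hx, ext_lineGauge_add_unitVec_ne n M e A h hx hν]
    exact res_nu n M e x hν (anchor_start n M e A h hx hν) (anchor_end n M e A h hx hν)
  · have hx' : blockReg n M S (x + unitVec (fine n M) ν) := hb.resolve_left hx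
    rw [ext_lineGauge_of_mem n M e S A hx', ext_lineGauge_of_not_mem n M e S A hx, ← muT_eq_zero_of_inward n M e A h hν hx hx']
    exact res_nu n M e x hν (anchor_start_inward n M e A h hν hx hx') (anchor_end_inward n M e A h hν hx hx')

/-! ## §4 Pointwise squared bounds -/

/-- Cauchy–Schwarz along a range: `‖Σ_{s<k} c s‖² ≤ k·Σ_{s<k} ‖c s‖²`. [folklore] -/
theorem norm_sum_range_sq_le (c : ℕ → ℂ) (k : ℕ) : ‖∑ s ∈ range k, c s‖ ^ 2 ≤ k * ∑ s ∈ range k, ‖c s‖ ^ 2 := by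
  calc ‖∑ s ∈ range k, c s‖ ^ 2 ≤ (∑ s ∈ range k, ‖c s‖) ^ 2 := by
        gcongr; exact norm_sum_le _ _
    _ ≤ (range k).card * ∑ s ∈ range k, ‖c s‖ ^ 2 := sq_sum_le_card_mul_sum_sq
    _ = k * ∑ s ∈ range k, ‖c s‖ ^ 2 := by rw [card_range]

/-- the CURL ENERGY OF THE LINE of `x` in the `(e,ν)`-plane: `Σ_{s ≤ n} ‖F_{eν}(xstart x + s·e)‖²`. [folklore] -/
def lineCurl (Z : Tor (fine n M) × Fin d → ℂ) (ν : Fin d) (x : Tor (fine n M)) : ℝ :=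
  ∑ s ∈ range (n + 1), ‖Fs (fine n M) (n : ℂ) Z e ν (xstart n M e x + tstep (fine n M) e s)‖ ^ 2

/-- `0 ≤ lineCurl`. [folklore] -/
theorem lineCurl_nonneg (Z : Tor (fine n M) × Fin d → ℂ) (ν : Fin d) (x : Tor (fine n M)) : 0 ≤ lineCurl n M e Z ν x :=
  sum_nonneg fun _ _ => by positivity

/-- a partial curl sum is dominated by the line: `‖curlSum x k‖² ≤ k·lineCurl x` for `k ≤ n + 1`. [folklore] -/
theorem norm_curlSum_sq_le (Z : Tor (fine n M) × Fin d → ℂ) (ν : Fin d) (x : Tor (fine n M)) {k : ℕ} (hk : k ≤ n + 1) :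
    ‖curlSum n M e Z ν x k‖ ^ 2 ≤ k * lineCurl n M e Z ν x := by
  unfold curlSum lineCurl
  refine (norm_sum_range_sq_le _ k).trans (mul_le_mul_of_nonneg_left ?_ (Nat.cast_nonneg k))
  exact sum_le_sum_of_subset_of_nonneg (range_mono hk) fun _ _ _ => by positivity

/-- **POINTWISE BOUND ON `e`-BONDS**: `‖res A (x,e)‖² ≤ (1_Ω(x)‖ℓ(x)‖² + 1_Ω(x+e)‖ℓ(x+e)‖²)/(n+1)²`. [folklore] -/
theorem norm_sq_res_e_le (h : IsEThin M e S) (x : Tor (fine n M)) :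
    ‖res n M e S A (x, e)‖ ^ 2
      ≤ ((if blockReg n M S x then ‖ell n M e (ext (starReg n M S) A) x‖ ^ 2 else 0)
          + (if blockReg n M S (x + unitVec (fine n M) e) then ‖ell n M e (ext (starReg n M S) A) (x + unitVec (fine n M) e)‖ ^ 2 else 0))
        / ((n : ℝ) + 1) ^ 2 := by
  have hn1 : (0 : ℝ) < (n : ℝ) + 1 := by positivity
  have hdiv : ∀ w : ℂ, ‖w / ((n : ℂ) + 1)‖ ^ 2 = ‖w‖ ^ 2 / ((n : ℝ) + 1) ^ 2 := fun w => by
    rw [norm_div, div_pow]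
    congr 2
    rw [show ((n : ℂ) + 1) = (((n : ℝ) + 1 : ℝ) : ℂ) by push_cast; rfl, Complex.norm_real, Real.norm_of_nonneg hn1.le]
  by_cases hx : blockReg n M S x
  · rw [res_e_of_mem n M e A h hx, hdiv, if_pos hx]
    gcongr
    split_ifs <;> nlinarith [norm_nonneg (ell n M e (ext (starReg n M S) A) (x + unitVec (fine n M) e))]
  · by_cases hx' : blockReg n M S (x + unitVec (fine n M) e)
    · rw [res_e_of_inward n M e A hx hx', hdiv, if_neg hx, if_pos hx', zero_add]
    · rw [res_of_not_star n M e S A (by rintro (h1 | h2) <;> [exact hx h1; exact hx' h2]), if_neg hx, if_neg hx', norm_zero, add_zero,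
        zero_pow two_ne_zero, zero_div]

/-- **POINTWISE BOUND ON TRANSVERSE BONDS** (`ν ≠ e`): `‖res A (x,ν)‖² ≤ (4/n)·(1_Ω(x) + 1_Ω(x+e_ν))·lineCurl ν x`. [folklore] -/
theorem norm_sq_res_nu_le (h : IsEThin M e S) {ν : Fin d} (hν : ν ≠ e) (x : Tor (fine n M)) :
    ‖res n M e S A (x, ν)‖ ^ 2
      ≤ 4 / (n : ℝ) * (((if blockReg n M S x then 1 else 0) + (if blockReg n M S (x + unitVec (fine n M) ν) then 1 else 0))
          * lineCurl n M e (ext (starReg n M S) A) ν x) := by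
  set Z := ext (starReg n M S) A with hZ
  set K := lineCurl n M e Z ν x with hK
  have hK0 : 0 ≤ K := lineCurl_nonneg n M e Z ν x
  have hn0 : (0 : ℝ) < n := by exact_mod_cast Nat.pos_of_ne_zero (NeZero.ne n)
  by_cases hb : starReg n M S (x, ν)
  · -- the indicator sum is at least one
    have hind : (1 : ℝ) ≤ (if blockReg n M S x then 1 else 0) + (if blockReg n M S (x + unitVec (fine n M) ν) then 1 else 0) := by
      rcases hb with h1 | h2
      · rw [if_pos h1]; split_ifs <;> norm_num
      · rw [if_pos h2]; split_ifs <;> norm_num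
    set t := edig n M e x with ht
    have htn : t + 1 ≤ n := edig_lt n M e x
    rw [res_nu_eq n M e A h hν hb]
    have h1 : ‖(n : ℂ)⁻¹ * curlSum n M e Z ν x (t + 1)‖ ^ 2 ≤ K / n := by
      rw [norm_mul, mul_pow, norm_inv, Complex.norm_natCast, inv_pow]
      have hc := norm_curlSum_sq_le n M e Z ν x (k := t + 1) (by omega)
      calc ((n : ℝ) ^ 2)⁻¹ * ‖curlSum n M e Z ν x (t + 1)‖ ^ 2 ≤ ((n : ℝ) ^ 2)⁻¹ * ((t + 1 : ℕ) * K) :=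
            mul_le_mul_of_nonneg_left hc (by positivity)
        _ ≤ ((n : ℝ) ^ 2)⁻¹ * (n * K) :=
            mul_le_mul_of_nonneg_left (mul_le_mul_of_nonneg_right (by exact_mod_cast htn) hK0) (by positivity)
        _ = K / n := by field_simp
    have h2 : ‖((t + 1 : ℕ) : ℂ) / ((n : ℂ) * ((n : ℂ) + 1)) * curlSum n M e Z ν x (n + 1)‖ ^ 2 ≤ K / n := by
      have hc := norm_curlSum_sq_le n M e Z ν x (k := n + 1) le_rfl
      have hnorm : ‖((t + 1 : ℕ) : ℂ) / ((n : ℂ) * ((n : ℂ) + 1))‖ = ((t + 1 : ℕ) : ℝ) / ((n : ℝ) * ((n : ℝ) + 1)) := by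
        rw [norm_div, Complex.norm_natCast, norm_mul, Complex.norm_natCast,
          show ((n : ℂ) + 1) = ((n + 1 : ℕ) : ℂ) by push_cast; rfl, Complex.norm_natCast]
        push_cast; rfl
      rw [norm_mul, mul_pow, hnorm, div_pow, mul_pow]
      have ht1 : ((t + 1 : ℕ) : ℝ) ≤ n := by exact_mod_cast htn
      have ht0 : (0 : ℝ) ≤ ((t + 1 : ℕ) : ℝ) := Nat.cast_nonneg _
      calc ((t + 1 : ℕ) : ℝ) ^ 2 / ((n : ℝ) ^ 2 * ((n : ℝ) + 1) ^ 2) * ‖curlSum n M e Z ν x (n + 1)‖ ^ 2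
          ≤ ((t + 1 : ℕ) : ℝ) ^ 2 / ((n : ℝ) ^ 2 * ((n : ℝ) + 1) ^ 2) * (((n + 1 : ℕ) : ℝ) * K) :=
            mul_le_mul_of_nonneg_left hc (by positivity)
        _ ≤ (n : ℝ) ^ 2 / ((n : ℝ) ^ 2 * ((n : ℝ) + 1) ^ 2) * (((n + 1 : ℕ) : ℝ) * K) := by gcongr
        _ = K / ((n : ℝ) + 1) := by push_cast; field_simp
        _ ≤ K / n := div_le_div_of_nonneg_left hK0 hn0 (by linarith)
    calc ‖(n : ℂ)⁻¹ * curlSum n M e Z ν x (t + 1) - ((t + 1 : ℕ) : ℂ) / ((n : ℂ) * ((n : ℂ) + 1)) * curlSum n M e Z ν x (n + 1)‖ ^ 2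
        ≤ 2 * (K / n) + 2 * (K / n) := by
          -- `‖u − v‖² ≤ 2‖u‖² + 2‖v‖²` (inlined; the tree's `Literature.Computability.QuantumComplexity.norm_sub_sq_le_two_mul`)
          have hsub : ∀ u v : ℂ, ‖u - v‖ ^ 2 ≤ 2 * ‖u‖ ^ 2 + 2 * ‖v‖ ^ 2 := fun u v => by
            nlinarith [norm_sub_le u v, norm_nonneg (u - v), norm_nonneg u, norm_nonneg v, sq_nonneg (‖u‖ - ‖v‖)]
          exact (hsub _ _).trans (by linarith)
      _ = 4 / (n : ℝ) * (1 * K) := by ring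
      _ ≤ 4 / (n : ℝ) * (((if blockReg n M S x then 1 else 0) + (if blockReg n M S (x + unitVec (fine n M) ν) then 1 else 0)) * K) := by
          gcongr
  · rw [res_of_not_star n M e S A hb, norm_zero, zero_pow two_ne_zero]
    have : 0 ≤ (if blockReg n M S x then (1:ℝ) else 0) + (if blockReg n M S (x + unitVec (fine n M) ν) then 1 else 0) := by
      split_ifs <;> norm_num
    positivity

end Summit.QuantumFields.BalabanUV.T4Continuum.RegionStarLineGaugeRegion

end
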